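import Summits.BirchSwinnertonDyer.BirchSwinnertonDyer.Theorems.KatoDescentTamePotSupersingularJetchevIrreducibleProp44AHalfConcrete
import Summits.BirchSwinnertonDyer.BirchSwinnertonDyer.Theorems.Rank1ResidualJetKolyvaginClassLocal
import Summits.BirchSwinnertonDyer.BirchSwinnertonDyer.Theorems.KolyvaginRoadThreePointCertificate
import Summits.BirchSwinnertonDyer.Rank1Residual.X11b.RingClassFieldNoTorsionOfIrreducible
import Summits.BirchSwinnertonDyer.Rank1Residual.X11b.SplitPrimeUnramified
import Literature.NumberTheory.EllipticCurves.WeilPairingProofs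
import Literature.NumberTheory.EllipticCurves.HeegnerPointsOfConductorRationalityProofs
import Literature.NumberTheory.EllipticCurves.RingClassGalOverCyclicProofs
import Summits.BirchSwinnertonDyer.BirchSwinnertonDyer.Theorems.ErratumRoadFiveNonSurjCornerKolyJProp44PairSelmer
import Summits.BirchSwinnertonDyer.BirchSwinnertonDyer.Theorems.Rank1ResidualJetRingClassFields
import Literature.NumberTheory.EllipticCurves.GrossLMS1991.HeegnerEulerSystemCongruenceImageFree
import Summits.BirchSwinnertonDyer.BirchSwinnertonDyer.Theorems.Rank1ResidualJetCebotarevAdapter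
import HarnessLib

/-!
# Route `PrintX9`, crux J = `HeegnerDivisibilityX9` (item 20392), stub `stub_jetchevX9`: Jetchev 2008 Prop. 4.7
# (= McCallum 1991 Prop. 4.4, the local-condition comparison `ord loc_λ c_M(cℓ) = ord loc_λ c_M(c)`) at a prime
# `p` SPLIT in the Heegner field with `E[p]` IRREDUCIBLE, from the image-free Eichler–Shimura congruence Gross 1991
# Prop. 3.7 (2) (`GrossLMS1991.prop37_2_frobeniusCongruence`, named Literature fact)

Cell `bsd-print-x9` (print tier, key `x9`), prover seat p4; `--supports stmt-BirchSwinnertonDyer-20392`,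
helper; THEOREMS ONLY, nothing booked, no item closed, BSD is not proved by any of this.

WHAT. The bsd-potss seats (k8t-c4 g10/g11) proved the irreducible reading of McCallum Prop. 4.4 for their rows
(`E[p]` irreducible, `p ∣ N_E`) modulo Gross Prop. 3.7 (2): `JetchevIrreducibleProp44.h47P2_of_prop37_2` over cell
bsd-stepL corner-p1's Zhang-pair END `Prop44.zsmul_kolyvaginClass_mem_selmerLocalKer_iff_of_compat` and the (A)-half
`zsmul_kolyvaginClass_mem_selmerLocalKer_iff_mem_torsionLocalKer_of_irreducible_of_heegner`, and the H63 adapter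
`JetchevIrreducibleH63P2.addOrderOf_localization_kolyvaginClass_mul_eq_of_prop47IrredP2`. The row binder `p ∣ N_E` is
used there ONLY for «`p` unramified in `K`» (admissibility `E(K[c])[p^M] = 0` from irreducibility, x11b3). This file
is those three steps with `(hpN : p ∣ N_E)` ↦ `(hHp : SatisfiesHeegnerHypothesis p K)` (`p` SPLIT in `K`), the
closed reading binder `h47P2` replaced by the named fact `h37 : GrossLMS1991.prop37_2_frobeniusCongruence` itself:
§1 the standing inputs `hA`/`hPt` and the (A)-half on split rows; §2 `zsmul_kolyvaginClass_mul_mem_torsionLocalKer_iff_of_prop37_2_of_split`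
(the (B)-conjunct: `p^j c_M(cℓ) ∈ Ker_λ ↔ p^j c_M(c) ∈ Ker_λ` for compatible data, `ℓ ≠ 2`); §3 the `h47` input of
the H63 row form: `addOrderOf_localization_kolyvaginClass_mul_eq_of_prop37_2_of_split`. Proofs VERBATIM up to the
binder. CONDITIONAL on the named fact `h37` only; nothing asserted about any curve.

References: [cite: McCallumLMS1991, §4 Prop. 4.4 (p. 301)] [cite: Jetchev2008, Prop. 4.7, Rem. 6.2]
[cite: GrossLMS1991, Prop. 3.7 (2), Lemma 4.3, Prop. 3.6] [cite: Nekovar2007, Prop. 4.13 (ii)]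
[cite: Howard2004HeegnerKolyvagin, Lemma 2.7.3].
-/

set_option autoImplicit false

noncomputable section

open scoped Classical Pointwise

open WeierstrassCurve NumberField IsDedekindDomain Field
  Literature.NumberTheory.GaloisRepresentations Literature.NumberTheory.EllipticCurves
  Literature.NumberTheory.EllipticCurves.KolyvaginCocycle Literature.NumberTheory.EllipticCurves.ModularForms
  Summit.BirchSwinnertonDyer.Rank1Residual Summit.BirchSwinnertonDyer.Rank1Residual.X11b
  Summit.BirchSwinnertonDyer.Rank1Residual.X11b.Three
  Summit.BirchSwinnertonDyer.BirchSwinnertonDyer.Theorems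

namespace Summit.BirchSwinnertonDyer.Rank1Residual.JET.Split

-- `K : Type`: the tree's ring-class class field theory is universe `0`.
variable {K : Type} [Field K] [NumberField K]

/-! ### §1 The standing inputs and the (A)-half of McCallum Prop. 4.4 on a split row -/

/-- **The standing inputs `hA`, `hPt` of the concrete Kolyvagin class on the crux's rows** (`E[p]` irreducible,
`p` split in `K`, Heegner field with `d_K ∉ {−3,−4}`, Zhang–Kolyvagin level `c` of index `≥ M`): admissibility of
`E(K[c]) ⊆ E(K̄)` for `p^M` (x11b3's irreducible no-torsion theorem) and `Γ_K`-invariance of `[P(c)]` mod `p^M`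
(KolyCert's Zhang-currency certificate over the coherent concrete family, Gross §3 CM facts PROVED).
[cite: GrossLMS1991, Lemma 4.3, Prop. 3.6] [cite: McCallumLMS1991, §4 (4), (5)] -/
theorem isAdmissible_and_mem_invPoints_of_irreducible_of_split (hK : IsImaginaryQuadratic K) (ι : K →+* ℂ)
    (W : WeierstrassCurve ℚ) [W.IsElliptic] [W.IsGloballyMinimal] [NeZero (W.conductorNorm ℤ)]
    (hD3 : NumberField.discr K ≠ -3) (hD4 : NumberField.discr K ≠ -4)
    (hH : SatisfiesHeegnerHypothesis (W.conductorNorm ℤ) K)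
    {p : ℕ} [Fact p.Prime] (hp2 : p ≠ 2) (hirr : W.HasIrreducibleModPGaloisRep p) (hHp : SatisfiesHeegnerHypothesis p K)
    (Dt : ModularParametrizationData W (W.conductorNorm ℤ)) (β : ℤ) {M : ℕ}
    {c : ℕ} (hc : Squarefree c)
    (hKol : ∀ q ∈ c.primeFactors, Zhang2014.IsKolyvaginPrime (W.conductorNorm ℤ) W K p q ∧
      M ≤ Zhang2014.kolyvaginIndex W p q)
    (d : KolyvaginHeegnerData Dt β ι c) :
    IsAdmissible (absoluteGaloisGroup K) d.pointsSubgroup ((p ^ M : ℕ) : ℤ) ∧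
      d.toGeomPoints d.derivedPoint ∈ invPoints (absoluteGaloisGroup K) d.pointsSubgroup ((p ^ M : ℕ) : ℤ) := by
  have hp : p.Prime := Fact.out
  have hc0 : c ≠ 0 := hc.ne_zero
  -- `p ∤ c` (Kolyvagin primes are `≠ p`)
  have hpc : ¬ p ∣ c := fun h ↦
    (hKol p (Nat.mem_primeFactors.mpr ⟨hp, h, hc0⟩)).1.2.2.2.1 rfl
  refine ⟨?_, ?_⟩
  · -- `hA` from irreducibility
    exact NoTorsionIrr.isAdmissible_pointsSubgroup_of_hasIrreducibleModPGaloisRep d hK hc0 hp hp2 hirr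
      (WeierstrassCurve.exists_weilPairing_holds W p)
      (X11b.isUnramifiedIn_of_satisfiesHeegnerHypothesis_of_dvd hK hHp hp (dvd_refl p)) hpc M
  · -- `hPt` from the point certificate over the coherent family through the divisors of `c`
    have hND : IsCoprime (W.conductorNorm ℤ : ℤ) (NumberField.discr K) :=
      KolyvaginAssembly.isCoprime_discr_of_satisfiesHeegnerHypothesis hK hH
    have hD : NumberField.discr K < -4 := KolyvaginAssembly.discr_lt_neg_four hK ⟨hD3, hD4⟩
    have hinert : ∀ (m' : ℕ), m' ∣ c → ∀ q ∈ m'.primeFactors, (Ideal.span {(q : 𝓞 K)}).IsPrime :=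
      fun m' hm' q hq ↦ (hKol q (Nat.primeFactors_mono hm' hc0 hq)).1.2.2.2.2.1
    have hne : ∀ m' : ℕ, m' ∣ c → Nonempty (KolyvaginHeegnerData Dt β ι m') := fun m' hm' ↦
      BirchSwinnertonDyer.Theorems.nonempty_kolyvaginHeegnerData_of_grossCM
        (phi_heegnerPointOfConductor_mem_range_map_ringClassField_holds (W.conductorNorm ℤ) W K)
        exists_generator_ringClassGalOver_holds hK hH Dt β ι d.dvd_sq_sub (hc.squarefree_of_dvd hm')
        (hinert m' hm')
    let data : (m' : ℕ) → m' ∣ c → KolyvaginHeegnerData Dt β ι m' := fun m' hm' ↦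
      if h : m' = c then h ▸ d else (hne m' hm').some
    have hdata : data c dvd_rfl = d := by simp [data]
    have h := KolyCert.toGeomPoints_derivedPoint_mem_invPoints_of_dvd_zhang hK ι Dt hp hND hD hc hKol data c
      dvd_rfl
    rwa [hdata] at h

/-- **McCallum Prop. 4.4 "`ord d_M(c)_λ = ord c_M(c)_λ`" — the (A)-conjunct of S5 — UNCONDITIONAL on the crux's rows**
(`E[p]` irreducible, `p` split in `K`, `K` Heegner for `N_E` with `d_K ∉ {−3,−4}`): for every concrete datum `d` at a
square-free Zhang–Kolyvagin level `c` of index `≥ M`, every prime `ℓ ∣ c`, the place `λ ∋ ℓ` and every `k : ℤ`,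
`k · c_M(c) ∈ selmerLocalKer λ ↔ k · c_M(c) ∈ torsionLocalKer λ`. No hypothesis on the image beyond irreducibility,
none on the reduction of `E` at `p` (`p` split is used only for `p` unramified in `K`), no CM hypothesis.
[cite: McCallumLMS1991, Prop. 4.4 (1)(3) (p. 301)] [cite: Jetchev2008, Prop. 4.7, Rem. 6.2]
[cite: Howard2004HeegnerKolyvagin, Lemma 2.7.3] -/
theorem zsmul_kolyvaginClass_mem_selmerLocalKer_iff_mem_torsionLocalKer_of_irreducible_of_split
    (hK : IsImaginaryQuadratic K) (ι : K →+* ℂ) [∀ j : ℕ, NumberField (ringClassField K ι j)]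
    (W : WeierstrassCurve ℚ) [W.IsElliptic] [W.IsGloballyMinimal] [NeZero (W.conductorNorm ℤ)]
    (hD3 : NumberField.discr K ≠ -3) (hD4 : NumberField.discr K ≠ -4)
    (hH : SatisfiesHeegnerHypothesis (W.conductorNorm ℤ) K)
    {p : ℕ} [Fact p.Prime] (hp2 : p ≠ 2) (hirr : W.HasIrreducibleModPGaloisRep p) (hHp : SatisfiesHeegnerHypothesis p K)
    (Dt : ModularParametrizationData W (W.conductorNorm ℤ)) (β : ℤ) {M : ℕ}
    {c ℓ : ℕ} (hc : Squarefree c) (hℓc : ℓ ∈ c.primeFactors)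
    (hKol : ∀ q ∈ c.primeFactors, Zhang2014.IsKolyvaginPrime (W.conductorNorm ℤ) W K p q ∧
      M ≤ Zhang2014.kolyvaginIndex W p q)
    (d : KolyvaginHeegnerData Dt β ι c)
    (v : HeightOneSpectrum (𝓞 K)) (hv : (ℓ : 𝓞 K) ∈ v.asIdeal) (k : ℤ) :
    k • d.kolyvaginClass (Fact.out : p.Prime) M ∈
        selmerLocalKer (W.baseChange K) (v.adicCompletion K) ((p ^ M : ℕ) : ℤ) ↔
      k • d.kolyvaginClass (Fact.out : p.Prime) M ∈
        (W.baseChange K).torsionLocalKer (v.adicCompletion K) ((p ^ M : ℕ) : ℤ) := by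
  obtain ⟨hA, hPt⟩ := isAdmissible_and_mem_invPoints_of_irreducible_of_split hK ι W hD3 hD4 hH hp2 hirr hHp
    Dt β hc hKol d
  exact JetchevIrreducibleProp44.zsmul_kolyvaginClass_mem_selmerLocalKer_iff_mem_torsionLocalKer hK ι W hp2
    hc hℓc
    (fun q hq ↦ (hKol q hq).1) (hKol ℓ hℓc).2 d hA hPt v hv k


/-! ### §2 The (B)-conjunct of McCallum Prop. 4.4 on a split row, from Gross 1991 Prop. 3.7 (2) -/

/-- **`p^j c_M(cℓ) ∈ Ker_λ ↔ p^j c_M(c) ∈ Ker_λ` for compatible data `(d, d')` at `(m, mℓ)`, `ℓ ≠ 2`, on a split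
row** (`E[p]` irreducible, odd `p` split in the Heegner field `K`, `d_K ∉ {−3,−4}`): potss k8t-c4 g11's
`JetchevIrreducibleProp44.h47P2_of_prop37_2` with explicit binders and `p ∣ N_E` ↦ `p` split — corner-p1's pair END
(p539541) gives `p^j c(d') ∈ Sel_λ ↔ p^j c(d) ∈ Ker_λ`, its (γ) binder fed by the named fact's `reductionCongruence`
(`ℓ ≠ 2`), its `hA`/`hPt` binders by §1, and the (A)-half of §1 turns `Sel_λ` into `Ker_λ` at `mℓ`.
CONDITIONAL on the named fact `h37`. [cite: McCallumLMS1991, §4 Prop. 4.4] [cite: GrossLMS1991, Prop. 3.7 (2)]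
[cite: Nekovar2007, Prop. 4.13 (ii)] [cite: Jetchev2008, Prop. 4.7] -/
theorem zsmul_kolyvaginClass_mul_mem_torsionLocalKer_iff_of_prop37_2_of_split
    (h37 : GrossLMS1991.prop37_2_frobeniusCongruence)
    (W : WeierstrassCurve ℚ) [W.IsElliptic] [W.IsGloballyMinimal] [NeZero (W.conductorNorm ℤ)]
    (K : Type) [Field K] [NumberField K] (hK : IsImaginaryQuadratic K)
    (hD3 : NumberField.discr K ≠ -3) (hD4 : NumberField.discr K ≠ -4)
    (hH : SatisfiesHeegnerHypothesis (W.conductorNorm ℤ) K)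
    (p : ℕ) [Fact p.Prime] (hp2 : p ≠ 2) (hirr : W.HasIrreducibleModPGaloisRep p)
    (hHp : SatisfiesHeegnerHypothesis p K)
    (Dt : ModularParametrizationData W (W.conductorNorm ℤ)) (β : ℤ) (ι : K →+* ℂ)
    (M : ℕ) (hM : 1 ≤ M) (m l : ℕ) (hml : Squarefree (m * l)) (hl : l.Prime) (hl2 : l ≠ 2) (_hlm : ¬ l ∣ m)
    (hK' : ∀ l' ∈ (m * l).primeFactors, Zhang2014.IsKolyvaginPrime (W.conductorNorm ℤ) W K p l' ∧
      M ≤ Zhang2014.kolyvaginIndex W p l')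
    (d : KolyvaginHeegnerData Dt β ι m) (d' : KolyvaginHeegnerData Dt β ι (m * l))
    (hσ : ∀ l' ∈ m.primeFactors, ∀ (x : ringClassField K ι m) (x' : ringClassField K ι (m * l)),
      (x : ℂ) = x' → ((d'.σ l' x' : ringClassField K ι (m * l)) : ℂ) = (d.σ l' x : ℂ))
    (hS : ∀ s ∈ d.S, ∃ s' ∈ d'.S, ∀ (x : ringClassField K ι m) (x' : ringClassField K ι (m * l)),
      (x : ℂ) = x' → ((s' x' : ringClassField K ι (m * l)) : ℂ) = (s x : ℂ))
    (hS' : ∀ s' ∈ d'.S, ∃ s ∈ d.S, ∀ (x : ringClassField K ι m) (x' : ringClassField K ι (m * l)),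
      (x : ℂ) = x' → ((s' x' : ringClassField K ι (m * l)) : ℂ) = (s x : ℂ))
    (hemb : ∀ (x : ringClassField K ι m) (x' : ringClassField K ι (m * l)),
      (x : ℂ) = x' → d'.emb x' = d.emb x)
    (v : HeightOneSpectrum (𝓞 K)) (hv : (l : 𝓞 K) ∈ v.asIdeal) (j : ℕ) :
    ((p ^ j : ℕ) : ℤ) • d'.kolyvaginClass (Fact.out : p.Prime) M ∈
        (W.baseChange K).torsionLocalKer (v.adicCompletion K) ((p ^ M : ℕ) : ℤ) ↔
      ((p ^ j : ℕ) : ℤ) • d.kolyvaginClass (Fact.out : p.Prime) M ∈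
        (W.baseChange K).torsionLocalKer (v.adicCompletion K) ((p ^ M : ℕ) : ℤ) := by
  have hp : p.Prime := Fact.out
  have hn0 : m * l ≠ 0 := hml.ne_zero
  have hln : l ∈ (m * l).primeFactors := Nat.mem_primeFactors.mpr ⟨hl, dvd_mul_left l m, hn0⟩
  have hml' : m * l / l = m := Nat.mul_div_cancel m hl.pos
  have hD : NumberField.discr K < -4 := KolyvaginAssembly.discr_lt_neg_four hK ⟨hD3, hD4⟩
  have hcop : Nat.Coprime (m * l) (W.conductorNorm ℤ) :=
    (KolyvaginH37Bridge.coprime_of_forall_not_dvd hn0 fun q hq ↦ (hK' q hq).1.2.1).symm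
  have hinert : (Ideal.span {(l : 𝓞 K)}).IsPrime := (hK' l hln).1.2.2.2.2.1
  haveI : ∀ k : ℕ, NumberField (ringClassField K ι k) := fun k ↦
    Summit.BirchSwinnertonDyer.Rank1Residual.JET.numberField_ringClassField K hK ι k
  -- standing inputs of the two classes (irreducibility + `p` unramified in `K`; KolyCert)
  obtain ⟨hA', hPt'⟩ := isAdmissible_and_mem_invPoints_of_irreducible_of_split hK ι W hD3 hD4 hH hp2 hirr hHp
    Dt β hml hK' d'
  have hKm : ∀ q ∈ m.primeFactors, Zhang2014.IsKolyvaginPrime (W.conductorNorm ℤ) W K p q ∧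
      M ≤ Zhang2014.kolyvaginIndex W p q :=
    fun q hq ↦ hK' q (Nat.primeFactors_mono (dvd_mul_right m l) hn0 hq)
  obtain ⟨hA, hPt⟩ := isAdmissible_and_mem_invPoints_of_irreducible_of_split hK ι W hD3 hD4 hH hp2 hirr hHp
    Dt β (hml.squarefree_of_dvd (dvd_mul_right m l)) hKm d
  -- (γ) at the pair, from the published fact (`ℓ ≠ 2`)
  have hγ : ∀ [Fact l.Prime] (hΔ : ¬ (l : ℤ) ∣ minimalDiscriminantInt W)
      (φ₀ : absoluteGaloisGroup (ZMod l)), (∀ x : AlgebraicClosure (ZMod l), φ₀ • x = x ^ l) →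
      ∀ (hle : ringClassField K ι m ≤ ringClassField K ι (m * l))
        (γ : ringClassField K ι (m * l) ≃ₐ[ℚ] ringClassField K ι (m * l)), γ ∈ ringClassGal ι (m * l) →
        geomReduction hΔ ((RatClosure.pointsEquiv (K := K) W).symm
            (d'.toGeomPoints (pointGalHom W (ringClassField K ι (m * l)) γ d'.y))) =
          φ₀ • geomReduction hΔ ((RatClosure.pointsEquiv (K := K) W).symm
            (d'.toGeomPoints (pointGalHom W (ringClassField K ι (m * l)) γ
              (WeierstrassCurve.Affine.Point.map (W' := W)
                (letI : Algebra K ℂ := ι.toAlgebra; (RingClassField.inclusion ι hle).restrictScalars ℚ)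
                d.y)))) := by
    -- transport the fact's corollary (data at `mℓ / ℓ`) to data at `m`
    have key : ∀ (m₀ : ℕ) (e : m * l / l = m₀) (d₀ : KolyvaginHeegnerData Dt β ι m₀) [Fact l.Prime]
        (hΔ : ¬ (l : ℤ) ∣ minimalDiscriminantInt W)
        (φ₀ : absoluteGaloisGroup (ZMod l)), (∀ x : AlgebraicClosure (ZMod l), φ₀ • x = x ^ l) →
        ∀ (hle : ringClassField K ι m₀ ≤ ringClassField K ι (m * l))
          (γ : ringClassField K ι (m * l) ≃ₐ[ℚ] ringClassField K ι (m * l)),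
          geomReduction hΔ ((RatClosure.pointsEquiv (K := K) W).symm
              (d'.toGeomPoints (pointGalHom W (ringClassField K ι (m * l)) γ d'.y))) =
            φ₀ • geomReduction hΔ ((RatClosure.pointsEquiv (K := K) W).symm
              (d'.toGeomPoints (pointGalHom W (ringClassField K ι (m * l)) γ
                (WeierstrassCurve.Affine.Point.map (W' := W)
                  (letI : Algebra K ℂ := ι.toAlgebra; (RingClassField.inclusion ι hle).restrictScalars ℚ)
                  d₀.y)))) := by
      intro m₀ e
      subst e
      intro d₀ _ hΔ φ₀ hφ₀ hle γ
      exact h37.reductionCongruence rfl hK ⟨hD3, hD4⟩ hH hml hcop hln (Or.inl hl2) hinert d' d₀ hΔ hφ₀ hle γ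
    intro _ hΔ φ₀ hφ₀ hle γ _
    exact key m hml' d hΔ φ₀ hφ₀ hle γ
  -- the pair END (corner-p1 g10): `Sel_λ` for `c(d')` ↔ `Ker_λ` for `c(d)`
  have hpair := Prop44.zsmul_kolyvaginClass_mem_selmerLocalKer_iff_of_compat hK ι hD hH Dt hp hp2 hM hml hK' hln
    hml' d' d hσ hS hS' hemb hγ hA' hA hPt' hPt v hv j
  -- the (A)-half at the top (this seat g10)
  have hAtop := zsmul_kolyvaginClass_mem_selmerLocalKer_iff_mem_torsionLocalKer_of_irreducible_of_split hK ι W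
    hD3 hD4 hH hp2 hirr hHp Dt β hml hln hK' d' v hv ((p : ℤ) ^ j)
  rw [show ((p ^ j : ℕ) : ℤ) = (p : ℤ) ^ j from Nat.cast_pow p j]
  exact hAtop.symm.trans hpair


/-! ### §3 The `h47` input of the H63 row form (Jetchev Prop. 4.7 as an equality of local orders) -/

/-- **Prop. 4.7 in the `h47` currency of bsd-jet's abstract Thm. 6.3 on a split row**: for compatible data `(d, d')`
at `(c, cℓ)` (`ℓ ≠ 2` a Kolyvagin prime of index `≥ M`, `ℓ ∤ c`) and the place `λ ∋ ℓ`,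
`ord loc_λ c_M(cℓ) = ord loc_λ c_M(c)` — potss `JetchevIrreducibleH63P2.addOrderOf_localization_kolyvaginClass_mul_eq_of_prop47IrredP2`
byte-for-byte with the reading `h47P2` replaced by §2 (named fact `h37`), `p ∣ N_E` ↦ `p` split, and the unused
non-CM binder dropped. CONDITIONAL on `h37`.
[cite: Jetchev2008, Prop. 4.7 (p. 819)] [cite: McCallumLMS1991, §4 Prop. 4.4, §3 p. 298 (local orders)] -/
theorem addOrderOf_localization_kolyvaginClass_mul_eq_of_prop37_2_of_split
    (h37 : GrossLMS1991.prop37_2_frobeniusCongruence)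
    (W : WeierstrassCurve ℚ) [W.IsElliptic] [W.IsGloballyMinimal] [NeZero (W.conductorNorm ℤ)]
    (K : Type) [Field K] [NumberField K] (hK : IsImaginaryQuadratic K)
    (hD3 : NumberField.discr K ≠ -3) (hD4 : NumberField.discr K ≠ -4)
    (hH : SatisfiesHeegnerHypothesis (W.conductorNorm ℤ) K)
    (p : ℕ) [Fact p.Prime] (hp2 : p ≠ 2) (hirr : W.HasIrreducibleModPGaloisRep p)
    (hHp : SatisfiesHeegnerHypothesis p K)
    (Dt : ModularParametrizationData W (W.conductorNorm ℤ)) (β : ℤ) (ι : K →+* ℂ)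
    (M : ℕ) (hM : 1 ≤ M) (m l : ℕ) (hml : Squarefree (m * l)) (hl : l.Prime) (hl2 : l ≠ 2) (hlm : ¬ l ∣ m)
    (hK' : ∀ l' ∈ (m * l).primeFactors, Zhang2014.IsKolyvaginPrime (W.conductorNorm ℤ) W K p l' ∧
      M ≤ Zhang2014.kolyvaginIndex W p l')
    (d : KolyvaginHeegnerData Dt β ι m) (d' : KolyvaginHeegnerData Dt β ι (m * l))
    (hσ : ∀ l' ∈ m.primeFactors, ∀ (x : ringClassField K ι m) (x' : ringClassField K ι (m * l)),
      (x : ℂ) = x' → ((d'.σ l' x' : ringClassField K ι (m * l)) : ℂ) = (d.σ l' x : ℂ))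
    (hS : ∀ s ∈ d.S, ∃ s' ∈ d'.S, ∀ (x : ringClassField K ι m) (x' : ringClassField K ι (m * l)),
      (x : ℂ) = x' → ((s' x' : ringClassField K ι (m * l)) : ℂ) = (s x : ℂ))
    (hS' : ∀ s' ∈ d'.S, ∃ s ∈ d.S, ∀ (x : ringClassField K ι m) (x' : ringClassField K ι (m * l)),
      (x : ℂ) = x' → ((s' x' : ringClassField K ι (m * l)) : ℂ) = (s x : ℂ))
    (hemb : ∀ (x : ringClassField K ι m) (x' : ringClassField K ι (m * l)),
      (x : ℂ) = x' → d'.emb x' = d.emb x)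
    (v : HeightOneSpectrum (𝓞 K)) (hv : (l : 𝓞 K) ∈ v.asIdeal) :
    addOrderOf ((galoisCohomology.localization
        ((W.baseChange K).torsionGaloisModule ((p ^ M : ℕ) : ℤ)) (Sum.inr v) 1 :
          galH1Torsion (W.baseChange K) ((p ^ M : ℕ) : ℤ) →+ _)
        (d'.kolyvaginClass (Fact.out : p.Prime) M)) =
      addOrderOf ((galoisCohomology.localization
        ((W.baseChange K).torsionGaloisModule ((p ^ M : ℕ) : ℤ)) (Sum.inr v) 1 :
          galH1Torsion (W.baseChange K) ((p ^ M : ℕ) : ℤ) →+ _)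
        (d.kolyvaginClass (Fact.out : p.Prime) M)) := by
  have hp : p.Prime := Fact.out
  set loc : galH1Torsion (W.baseChange K) ((p ^ M : ℕ) : ℤ) →+
      galoisCohomology (((W.baseChange K).torsionGaloisModule ((p ^ M : ℕ) : ℤ)).toLocal (Sum.inr v)) 1 :=
    galoisCohomology.localization ((W.baseChange K).torsionGaloisModule ((p ^ M : ℕ) : ℤ)) (Sum.inr v) 1
    with hlocdef
  have hloc : ∀ (z : galH1Torsion (W.baseChange K) ((p ^ M : ℕ) : ℤ)) (j : ℕ), loc (p ^ j • z) = 0 ↔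
      ((p ^ j : ℕ) : ℤ) • z ∈ (W.baseChange K).torsionLocalKer (v.adicCompletion K) ((p ^ M : ℕ) : ℤ) := by
    intro z j
    haveI : CharZero (v.adicCompletion K) := charZero_of_injective_algebraMap (algebraMap K _).injective
    rw [hlocdef, natCast_zsmul, mem_torsionLocalKer_iff_res_eq_zero (W := W.baseChange K)
      (E := v.adicCompletion K) (pow_ne_zero M hp.ne_zero)]
    exact Iff.rfl
  have hkillL : ∀ z : galH1Torsion (W.baseChange K) ((p ^ M : ℕ) : ℤ), p ^ M • loc z = 0 := fun z ↦
    galoisCohomology.nsmul_eq_zero_of_forall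
      (((W.baseChange K).torsionGaloisModule ((p ^ M : ℕ) : ℤ)).toLocal (Sum.inr v))
      (fun T ↦ by
        have h := (W.baseChange K).natAbs_nsmul_geomTorsion T
        rwa [Int.natAbs_natCast] at h) (loc z)
  have h := zsmul_kolyvaginClass_mul_mem_torsionLocalKer_iff_of_prop37_2_of_split h37 W K hK hD3 hD4 hH p hp2 hirr
    hHp Dt β ι M hM m l hml hl hl2 hlm hK' d d' hσ hS hS' hemb v hv
  refine addOrderOf_eq_addOrderOf_of_forall_nsmul_eq_zero_iff hp (hkillL _) (hkillL _) fun j ↦ ?_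
  rw [← map_nsmul, ← map_nsmul]
  exact (hloc _ j).trans ((h j).trans (hloc _ j).symm)


end Summit.BirchSwinnertonDyer.Rank1Residual.JET.Split

end
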